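import Summits.BirchSwinnertonDyer.Rank1Residual.X11b.BDPRouteUpperLinksInert
import Summits.BirchSwinnertonDyer.Rank1Residual.X11b.BDPRouteUpperLinks
import HarnessLib

/-!
# Class X11b, route "BDP + converse-theorem engine + Kolyvagin": the numeric Tamagawa condition of the Shimura links holds for the field of JSW §7.4.2 (cell `b2b-bsdres`, sub-cell `multr1-p2`, gen 9)

HONEST FRAMING (verbatim, cell `b2b-bsdres`): the goal of the cell is to DELETE the
COMBINATION-SHAPED residual classes for ALL analytic-rank `≤ 1` curves over `ℚ` — "full BSD
formula for every rank `≤ 1` curve in class `C`" assembled STRICTLY from published theorems — so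
that the rank-`≤ 1` remainder becomes exactly the CONSTRUCTION-SHAPED classes, which are TYPED
(missing-input Props), NOT attempted; this is not "finishing BSD". Research route `p2` for class
X11b; no claim beyond the stated class; nothing booked; X11b stays CONSTRUCTION-SHAPED. Theorems
only (no definition, no new named fact).

## What this file does

`X11b/BDPRouteUpperLinks.lean` (gen 9) derives the Euler-system half (T2) of `BSD(E,p)` from the
two Shimura-curve shapes of Jetchev–Skinner–Wan 2017 §7.4.2 at a quadratic field `K`, granted the
NUMERIC Tamagawa condition `ord_p ∏c(E) + ord_p ∏c(E^{d_K}) ≤ T`, `T` being the `N⁻`-term of the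
Gross–Zagier shape. This file PROVES that condition for the field of JSW §7.4.2 — the bad primes
of a finite set `S` ("`N⁻`") ODD, INERT in `K` (`(d_K/ℓ) = −1`) and multiplicative for `E`, every
other bad prime SPLIT (`d_K` a square in `ℚ_ℓ`), and every split multiplicative prime `ℓ ∉ S` of
`E` très ramifié (`p ∤ ord_ℓ Δ_min`) — with `T = Σ_{ℓ ∈ S} ord_p(ord_ℓ Δ_min(E))`, which is JSW's
`ord_p ∏_{ℓ ∣ N⁻} c_ℓ(E/K″)` (at an inert multiplicative place `c = ord_ℓ Δ`). Prime by prime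
(Kodaira–Néron, Silverman *ATAEC* IV.9.2; Tate's algorithm under a unit twist, *AEC* VII.5):

* `ℓ ∈ S` (odd, `(d_K/ℓ) = −1`, multiplicative): `d_K` is a non-square `ℓ`-adic unit, so EXACTLY ONE
  of `E`, `E^{d_K}` is split multiplicative at `ℓ` (`hasSplitMultiplicativeReduction_quadraticTwist_iff`),
  both with `ord_ℓ Δ_min(E)` (`padicValInt_minimalDiscriminantInt_twist_eq_of_jacobiSym`): the split
  one has `c_ℓ = ord_ℓ Δ_min(E)`, the other `c_ℓ ≤ 4` — contribution `ord_p(ord_ℓ Δ_min(E))`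
  (`padicValNat_localTamagawaNumber_add_twist_le_of_inert`);
* `ℓ ∣ N`, `ℓ ∉ S` (split): `E^{d_K} ≅ E` over `ℚ_ℓ`, `c_ℓ(E^{d_K}) = c_ℓ(E)`, and `p ∤ c_ℓ(E)`
  because `ℓ` is not split multiplicative with `p ∣ ord_ℓ Δ_min` (`localTamagawaNumber_twist_eq_of_isSquare`);
* `ℓ ∤ N`: `c_ℓ(E) = 1`, `E^{d_K}` good or additive at `ℓ`, `c_ℓ ≤ 4`.
This file (part 2 of 2; the inert prime is `BDPRouteUpperLinksInert.lean`) does the split and the good primes and sums over all places: main theorem `padicValNat_tamagawaProduct_add_twist_le_of_inertSet`; combined with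
`missingUpperBoundAt_of_shimuraShapes` it leaves, on (T2β)∖(T2α), EXACTLY the two shapes (U-Sh),
(GZ-Sh) at such a field and the field's existence (Friedberg–Hoffstein with prescribed local
behaviour) as the untyped inputs of the upper half. CONDITIONAL theorems downstream; nothing
booked; labels unchanged. `ℓ = 2 ∈ S` is not treated (the unit-twist lemmas need `2 ∈ ℤ_ℓ^×`).

References: [SilvermanATAEC1994] Cor. IV.9.2; [SilvermanAEC2009] VII.1 Prop. 1.3, VII.5 Prop. 5.1,
X.5 Cor. 5.4; [JetchevSkinnerWan2017] §7.4.2 (p. 31), §7.3.1 (eq:tamK).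
-/

noncomputable section

open scoped Classical

open WeierstrassCurve NumberField IsDedekindDomain Literature.NumberTheory.EllipticCurves
  Rat.HeightOneSpectrum
  Literature.NumberTheory.EllipticCurves.Rank1Residual
  Literature.NumberTheory.EllipticCurves.Rank1Residual.Typed
  Literature.NumberTheory.EllipticCurves.ModularForms

namespace Summit.BirchSwinnertonDyer.Rank1Residual.X11b

/-! ### The (ram) witness may be inert -/

section InertWitness

variable (W : WeierstrassCurve ℚ) [W.IsElliptic] [W.IsGloballyMinimal]
  (K : Type) [Field K] [NumberField K]
  {Wd : WeierstrassCurve ℚ} [Wd.IsElliptic] [Wd.IsGloballyMinimal] (Cd : VariableChange ℚ)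
  (hWd : Cd • W.quadraticTwist (NumberField.discr K : ℚ) = Wd)
  (ℓ : ℕ) [Fact ℓ.Prime] (hℓ2 : ℓ ≠ 2) (hJ : jacobiSym (NumberField.discr K) ℓ = -1)

include hWd hℓ2 hJ

omit [Wd.IsElliptic] [Wd.IsGloballyMinimal] in
/-- **Multiplicative reduction survives the twist by an `ℓ`-adic unit** (`ℓ` odd, `(d_K/ℓ) = −1`):
`E^{d_K}` is multiplicative at a multiplicative prime `ℓ` of `E` that is inert in `K` (Silverman
*AEC* VII.5 Prop. 5.1(b): the type depends on `v(Δ), v(c₄)`, unchanged by a unit twist; tree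
`hasMultiplicativeReduction_quadraticTwist_iff`, transported between minimal equations).
[cite: SilvermanAEC2009, VII.5 Prop. 5.1(b) and VII.1 Prop. 1.3(b)] -/
theorem mult_twist_of_jacobiSym (hmult : Mult W ℓ) : Mult Wd ℓ := by
  set d : ℤ := NumberField.discr K with hd_def
  have hℓd : ¬ (ℓ : ℤ) ∣ d := not_dvd_of_jacobiSym_eq_neg_one hJ
  have hd0 : d ≠ 0 := by rw [hd_def]; exact NumberField.discr_ne_zero K
  have hD0 : (d : ℚ) ≠ 0 := by exact_mod_cast hd0
  haveI : (W.quadraticTwist (d : ℚ)).IsElliptic := W.isElliptic_quadraticTwist hD0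
  set u : ℤ_[ℓ]ˣ := (isUnit_intCast_padicInt_of_not_dvd hℓd).unit with hu_def
  have hu : (u : ℤ_[ℓ]) = (d : ℤ_[ℓ]) := rfl
  have hu' : algebraMap ℤ_[ℓ] ℚ_[ℓ] (u : ℤ_[ℓ]) = algebraMap ℚ ℚ_[ℓ] (d : ℚ) := by
    rw [hu]; simp
  set X : WeierstrassCurve ℚ_[ℓ] := W.baseChange ℚ_[ℓ] with hX
  set Y : WeierstrassCurve ℚ_[ℓ] := Wd.baseChange ℚ_[ℓ] with hY
  haveI hXmin : X.IsMinimal ℤ_[ℓ] := isMinimal_map_padic_of_isGloballyMinimal W ℓ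
  set Y' : WeierstrassCurve ℚ_[ℓ] := X.quadraticTwist (algebraMap ℤ_[ℓ] ℚ_[ℓ] (u : ℤ_[ℓ])) with hY'
  haveI hY'min : Y'.IsMinimal ℤ_[ℓ] := isMinimal_quadraticTwist ℤ_[ℓ] X (isUnit_two_padicInt hℓ2) u
  have hX0 : X.Δ ≠ 0 := by
    rw [hX, baseChange, map_Δ, ← cast_minimalDiscriminantInt W, map_intCast]
    exact_mod_cast minimalDiscriminantInt_ne_zero W
  have hY'0 : Y'.Δ ≠ 0 := by
    rw [hY', quadraticTwist_Δ]
    exact mul_ne_zero (pow_ne_zero 6 (by rw [hu']; exact (map_ne_zero _).mpr hD0)) hX0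
  have hYY' : Y = Cd.map (algebraMap ℚ ℚ_[ℓ]) • Y' := by
    rw [hY, ← hWd, WeierstrassCurve.VariableChange.baseChange_smul_eq (W.quadraticTwist (d : ℚ)) Cd
      ℚ_[ℓ], baseChange, map_quadraticTwist, ← hu', hY', hX, baseChange]
  obtain ⟨C₁, hC₁⟩ : ∃ C : VariableChange ℚ_[ℓ], X.minimal ℤ_[ℓ] = C • X := ⟨_, rfl⟩
  obtain ⟨C₂, hC₂⟩ : ∃ C : VariableChange ℚ_[ℓ], Y.minimal ℤ_[ℓ] = C • Y := ⟨_, rfl⟩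
  have hC₂' : Y.minimal ℤ_[ℓ] = (C₂ * Cd.map (algebraMap ℚ ℚ_[ℓ])) • Y' := by
    rw [hC₂, hYY', mul_smul]
  have hXmult : X.HasMultiplicativeReduction ℤ_[ℓ] :=
    (hasMultiplicativeReduction_iff_of_isMinimal_of_eq_smul ℤ_[ℓ] hC₁ hX0).mp hmult
  have hY'mult : Y'.HasMultiplicativeReduction ℤ_[ℓ] :=
    (hasMultiplicativeReduction_quadraticTwist_iff ℤ_[ℓ]).mpr hXmult
  exact (hasMultiplicativeReduction_iff_of_isMinimal_of_eq_smul ℤ_[ℓ] hC₂' hY'0).mpr hY'mult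

/-- **The (ram) predicate passes to the twist through an INERT witness** `ℓ ≠ p` (odd, multiplicative,
`p ∤ ord_ℓ Δ_min(E)`, `(d_K/ℓ) = −1`), with the same witness. [folklore] -/
theorem ram_twist_of_inert_witness (p : ℕ) [Fact p.Prime] (hℓp : ℓ ≠ p) (hmult : Mult W ℓ)
    (hv : ¬ p ∣ padicValInt ℓ W.minimalDiscriminantInt) : Ram Wd p := by
  refine ⟨ℓ, inferInstance, hℓp, mult_twist_of_jacobiSym W K Cd hWd ℓ hℓ2 hJ hmult, ?_⟩
  rwa [padicValInt_minimalDiscriminantInt_twist_eq_of_jacobiSym W K Cd hWd ℓ hℓ2 hJ]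

end InertWitness

/-! ### The split and the unramified-good primes -/

section Split

variable (W : WeierstrassCurve ℚ) [W.IsElliptic] [W.IsGloballyMinimal]
  (K : Type) [Field K] [NumberField K]
  {Wd : WeierstrassCurve ℚ} [Wd.IsElliptic] [Wd.IsGloballyMinimal] (Cd : VariableChange ℚ)
  (hWd : Cd • W.quadraticTwist (NumberField.discr K : ℚ) = Wd)
  (ℓ : ℕ) [Fact ℓ.Prime]

include hWd

omit [W.IsGloballyMinimal] [Wd.IsElliptic] [Wd.IsGloballyMinimal] in
/-- **`c_ℓ(E^{d_K}) = c_ℓ(E)` at a prime where `d_K` is a square in `ℚ_ℓ`** (split in `K`):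
`E^{d_K} ≅ E` over `ℚ_ℓ` and `c_ℓ` is a `ℚ_ℓ`-isomorphism invariant (Silverman VII.6 Ex. 7.6); the split
branch of `padicValNat_localTamagawaNumber_twist_eq` keyed on the prime. [cite: SilvermanAEC2009, VII.6 Ex. 7.6 and X.5 Cor. 5.4] -/
theorem localTamagawaNumber_twist_eq_of_isSquare
    (hsq : IsSquare (algebraMap ℚ ℚ_[ℓ] (NumberField.discr K : ℚ))) :
    (Wd.baseChange ℚ_[ℓ]).localTamagawaNumber ℤ_[ℓ] = (W.baseChange ℚ_[ℓ]).localTamagawaNumber ℤ_[ℓ] := by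
  set d : ℚ := (NumberField.discr K : ℚ) with hd_def
  have hD0 : d ≠ 0 := by rw [hd_def]; exact_mod_cast NumberField.discr_ne_zero K
  haveI : (W.baseChange ℚ_[ℓ]).IsElliptic := inferInstanceAs (W.map (algebraMap ℚ ℚ_[ℓ])).IsElliptic
  haveI : (W.quadraticTwist d).IsElliptic := W.isElliptic_quadraticTwist hD0
  obtain ⟨θ, hθ⟩ := hsq
  have hθ0 : θ ≠ 0 := by
    rintro rfl
    exact (map_ne_zero (algebraMap ℚ ℚ_[ℓ])).mpr hD0 (hθ.trans (mul_zero 0))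
  obtain ⟨C, hC⟩ := (W.baseChange ℚ_[ℓ]).exists_variableChange_smul_eq_quadraticTwist_sq hθ0
  have h1 : (W.quadraticTwist d).baseChange ℚ_[ℓ] = C • W.baseChange ℚ_[ℓ] := by
    rw [hC, baseChange, baseChange, map_quadraticTwist, hθ, sq]
  have hYX : Wd.baseChange ℚ_[ℓ] = (Cd.map (algebraMap ℚ ℚ_[ℓ]) * C) • W.baseChange ℚ_[ℓ] := by
    rw [← hWd, WeierstrassCurve.VariableChange.baseChange_smul_eq (W.quadraticTwist d) Cd ℚ_[ℓ],
      h1, mul_smul]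
  rw [hYX, localTamagawaNumber_variableChange_holds ℤ_[ℓ] (W.baseChange ℚ_[ℓ])
    (Cd.map (algebraMap ℚ ℚ_[ℓ]) * C)]

omit [W.IsGloballyMinimal] in
/-- **At a prime of good reduction of `E`, `p ∤ c_ℓ(E) c_ℓ(E^{d_K})` for `p ≥ 5`**: `c_ℓ(E) = 1`, and
`E^{d_K}` (same `j`, integral at `ℓ`) is not multiplicative at `ℓ`, so `0 < c_ℓ(E^{d_K}) ≤ 4`
(Kodaira–Néron). [cite: SilvermanATAEC1994, Cor. IV.9.2(d) (PDF p. 340)] -/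
theorem padicValNat_localTamagawaNumber_add_twist_eq_zero_of_good (p : ℕ) [Fact p.Prime]
    (hp5 : 5 ≤ p) (hgood : W.HasGoodReductionAtPrime ℓ) :
    padicValNat p ((W.baseChange ℚ_[ℓ]).localTamagawaNumber ℤ_[ℓ]) +
      padicValNat p ((Wd.baseChange ℚ_[ℓ]).localTamagawaNumber ℤ_[ℓ]) = 0 := by
  set d : ℚ := (NumberField.discr K : ℚ) with hd_def
  have hD0 : d ≠ 0 := by rw [hd_def]; exact_mod_cast NumberField.discr_ne_zero K
  haveI : (Wd.baseChange ℚ_[ℓ]).IsElliptic := inferInstanceAs (Wd.map (algebraMap ℚ ℚ_[ℓ])).IsElliptic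
  haveI : (W.quadraticTwist d).IsElliptic := W.isElliptic_quadraticTwist hD0
  have hcW : (W.baseChange ℚ_[ℓ]).localTamagawaNumber ℤ_[ℓ] = 1 := by
    haveI : ((W.baseChange ℚ_[ℓ]).minimal ℤ_[ℓ]).HasGoodReduction ℤ_[ℓ] := hgood
    exact localTamagawaNumber_eq_one_of_hasGoodReduction_holds ℤ_[ℓ] _
  have hj : Wd.j = W.j := by
    subst hWd
    rw [variableChange_j]
    exact W.j_quadraticTwist hD0
  have hns : ¬ ((Wd.baseChange ℚ_[ℓ]).minimal ℤ_[ℓ]).HasSplitMultiplicativeReduction ℤ_[ℓ] :=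
    fun hs ↦ not_hasMultiplicativeReductionAtPrime_of_j_eq hj ℓ hgood hs.toHasMultiplicativeReduction
  have h4 := localTamagawaNumber_padic_le_four ℓ (Wd.baseChange ℚ_[ℓ]) hns
  have hne := localTamagawaNumber_padic_ne_zero_holds ℓ (Wd.baseChange ℚ_[ℓ])
  rw [hcW, padicValNat_one_right, zero_add, padicValNat.eq_zero_of_not_dvd]
  intro hdvd
  have := Nat.le_of_dvd (Nat.pos_of_ne_zero hne) hdvd
  omega

omit [Wd.IsElliptic] [Wd.IsGloballyMinimal] in
/-- **At a split prime outside the très-ramifié obstruction, `p ∤ c_ℓ(E) c_ℓ(E^{d_K})`** (`d_K` a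
square in `ℚ_ℓ`, `ℓ` not split multiplicative with `p ∣ ord_ℓ Δ_min`, `p ≥ 5`): `c_ℓ(E^{d_K}) = c_ℓ(E)`
and `p ∣ c_ℓ(E)` would force exactly that (Kodaira–Néron). [cite: SilvermanATAEC1994, Cor. IV.9.2(d) with (b) (PDF p. 340)] -/
theorem padicValNat_localTamagawaNumber_add_twist_eq_zero_of_isSquare (p : ℕ) [Fact p.Prime]
    (hp5 : 5 ≤ p) (hsq : IsSquare (algebraMap ℚ ℚ_[ℓ] (NumberField.discr K : ℚ)))
    (hFC : W.HasSplitMultiplicativeReductionAtPrime ℓ → ¬ p ∣ padicValInt ℓ W.minimalDiscriminantInt) :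
    padicValNat p ((W.baseChange ℚ_[ℓ]).localTamagawaNumber ℤ_[ℓ]) +
      padicValNat p ((Wd.baseChange ℚ_[ℓ]).localTamagawaNumber ℤ_[ℓ]) = 0 := by
  haveI : (W.baseChange ℚ_[ℓ]).IsElliptic := inferInstanceAs (W.map (algebraMap ℚ ℚ_[ℓ])).IsElliptic
  rw [localTamagawaNumber_twist_eq_of_isSquare W K Cd hWd ℓ hsq, ← two_mul, mul_eq_zero]
  refine Or.inr ?_
  rw [padicValNat.eq_zero_of_not_dvd]
  intro hdvd
  have hs : W.HasSplitMultiplicativeReductionAtPrime ℓ :=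
    hasSplitMultiplicativeReduction_of_five_le_of_dvd_localTamagawaNumber ℓ _ hp5 hdvd
  obtain ⟨v, hv⟩ : ∃ v : HeightOneSpectrum ℤ, (primesEquiv v : ℕ) = ℓ :=
    ⟨primesEquiv.symm ⟨ℓ, Fact.out⟩, by rw [Equiv.apply_symm_apply]⟩
  rw [localTamagawaNumber_eq_padicValInt_of_split W v hv hs] at hdvd
  exact hFC hs hdvd

end Split

/-! ### The field of JSW §7.4.2: the numeric Tamagawa condition -/

/-- `ord_p` of a finite product of non-zero naturals is the sum of the `ord_p`. [folklore] -/
private theorem padicValNat_finset_prod' (p : ℕ) [Fact p.Prime] {ι : Type*} (s : Finset ι)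
    (f : ι → ℕ) (hf : ∀ i ∈ s, f i ≠ 0) :
    padicValNat p (∏ i ∈ s, f i) = ∑ i ∈ s, padicValNat p (f i) := by
  induction s using Finset.induction_on with
  | empty => simp
  | insert a s ha ih =>
    rw [Finset.prod_insert ha, Finset.sum_insert ha,
      padicValNat.mul (hf a (Finset.mem_insert_self a s))
        (Finset.prod_ne_zero_iff.mpr fun i hi => hf i (Finset.mem_insert_of_mem hi)),
      ih fun i hi => hf i (Finset.mem_insert_of_mem hi)]

/-- **The numeric Tamagawa condition of the Shimura links for the field `K″` of
Jetchev–Skinner–Wan 2017 §7.4.2.** `W/ℚ` globally minimal, `p ≥ 5`, `K` a quadratic field,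
`Wd = Cd • W^{(d_K)}` globally minimal, `S` a finite set of primes ("`N⁻`") such that: every `ℓ ∈ S` is
ODD, INERT in `K` (`(d_K/ℓ) = −1`) and multiplicative for `E`; every bad prime `ℓ ∉ S` of `E` SPLITS
in `K` (`d_K` a square in `ℚ_ℓ`); and every split multiplicative prime `ℓ ∉ S` of `E` has
`p ∤ ord_ℓ Δ_min` (the offending primes of the (T2) support — `dvd_tamagawaProduct_iff_exists_split` —
are all in `S`; in particular `E` is not "split and peu ramifié at `p`", shape (T2α)). Then
`ord_p ∏_ℓ c_ℓ(E) + ord_p ∏_ℓ c_ℓ(E^{d_K}) ≤ Σ_{ℓ ∈ S} ord_p(ord_ℓ Δ_min(E))` — the right side being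
JSW's `ord_p ∏_{ℓ∣N⁻} c_ℓ(E/K″)` (`c = ord_ℓ Δ` at an inert multiplicative place). Feeds the
hypothesis `hT` of `missingUpperBoundAt_of_shimuraShapes` (`BDPRouteUpperLinks.lean`).
[cite: JetchevSkinnerWan2017, §7.4.2 (p. 31) and §7.3.1 (eq:tamK)]
[cite: SilvermanATAEC1994, Cor. IV.9.2(d) with (b) (PDF p. 340)] -/
theorem padicValNat_tamagawaProduct_add_twist_le_of_inertSet
    (W : WeierstrassCurve ℚ) [W.IsElliptic] [W.IsGloballyMinimal] (p : ℕ) [Fact p.Prime]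
    (hp5 : 5 ≤ p) (K : Type) [Field K] [NumberField K]
    {Wd : WeierstrassCurve ℚ} [Wd.IsElliptic] [Wd.IsGloballyMinimal] (Cd : VariableChange ℚ)
    (hWd : Cd • W.quadraticTwist (NumberField.discr K : ℚ) = Wd)
    (S : Finset ℕ)
    (hS : ∀ ℓ ∈ S, ∃ _ : Fact ℓ.Prime, ℓ ≠ 2 ∧ jacobiSym (NumberField.discr K) ℓ = -1 ∧ Mult W ℓ)
    (hsplit : ∀ (ℓ : ℕ) [Fact ℓ.Prime], ¬ W.HasGoodReductionAtPrime ℓ → ℓ ∉ S →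
      IsSquare (algebraMap ℚ ℚ_[ℓ] (NumberField.discr K : ℚ)))
    (hFC : ∀ (ℓ : ℕ) [Fact ℓ.Prime], ℓ ∉ S → W.HasSplitMultiplicativeReductionAtPrime ℓ →
      ¬ p ∣ padicValInt ℓ W.minimalDiscriminantInt) :
    padicValNat p W.tamagawaProduct + padicValNat p Wd.tamagawaProduct ≤
      ∑ ℓ ∈ S, padicValNat p (padicValInt ℓ W.minimalDiscriminantInt) := by
  have hp : p.Prime := Fact.out
  -- the union of the bad places of `W` and `Wd`
  have hfW : (W.badPlaces ℤ).Finite := W.finite_badPlaces_holds ℤ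
  have hfWd : (Wd.badPlaces ℤ).Finite := Wd.finite_badPlaces_holds ℤ
  set s : Finset (HeightOneSpectrum ℤ) := hfW.toFinset ∪ hfWd.toFinset with hs
  have hsW : ∀ v, ¬ W.HasGoodReductionAt v → v ∈ s := fun v hv ↦
    Finset.mem_union_left _ (by rw [Set.Finite.mem_toFinset, mem_badPlaces_iff]; exact hv)
  have hsWd : ∀ v, ¬ Wd.HasGoodReductionAt v → v ∈ s := fun v hv ↦
    Finset.mem_union_right _ (by rw [Set.Finite.mem_toFinset, mem_badPlaces_iff]; exact hv)
  -- local exponents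
  set f : HeightOneSpectrum ℤ → ℕ := fun v ↦
    haveI := Fact.mk (primesEquiv v).2
    padicValNat p ((W.baseChange ℚ_[primesEquiv v]).localTamagawaNumber ℤ_[primesEquiv v]) +
      padicValNat p ((Wd.baseChange ℚ_[primesEquiv v]).localTamagawaNumber ℤ_[primesEquiv v]) with hf
  set g : ℕ → ℕ := fun ℓ ↦ padicValNat p (padicValInt ℓ W.minimalDiscriminantInt) with hg
  -- termwise bound: `f v ≤ g ℓ_v` if `ℓ_v ∈ S`, else `f v = 0`
  have hterm : ∀ v : HeightOneSpectrum ℤ,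
      f v ≤ if (primesEquiv v : ℕ) ∈ S then g (primesEquiv v : ℕ) else 0 := by
    intro v
    haveI := Fact.mk (primesEquiv v).2
    have key : ∀ (q : ℕ) (hq : Fact q.Prime), (primesEquiv v : ℕ) = q →
        padicValNat p (@WeierstrassCurve.localTamagawaNumber ℤ_[q] _ _ _ ℚ_[q] _ _ _ (W.baseChange ℚ_[q])) +
          padicValNat p (@WeierstrassCurve.localTamagawaNumber ℤ_[q] _ _ _ ℚ_[q] _ _ _ (Wd.baseChange ℚ_[q])) ≤
          if q ∈ S then g q else 0 := by
      rintro q hq hvq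
      by_cases hqS : q ∈ S
      · obtain ⟨_, hq2, hJ, hmult⟩ := hS q hqS
        rw [if_pos hqS, hg]
        exact padicValNat_localTamagawaNumber_add_twist_le_of_inert W K Cd hWd q hq2 hJ p hp5 hmult
      · rw [if_neg hqS, Nat.le_zero]
        by_cases hgood : W.HasGoodReductionAtPrime q
        · exact padicValNat_localTamagawaNumber_add_twist_eq_zero_of_good W K Cd hWd q p hp5 hgood
        · exact padicValNat_localTamagawaNumber_add_twist_eq_zero_of_isSquare W K Cd hWd q p hp5
            (hsplit q hgood hqS) (hFC q hqS)
    exact key _ _ rfl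
  -- sum over the places
  rw [tamagawaProduct_eq_prod W s hsW, tamagawaProduct_eq_prod Wd s hsWd,
    padicValNat_finset_prod' p s _ fun v _ ↦ ?_, padicValNat_finset_prod' p s _ fun v _ ↦ ?_,
    ← Finset.sum_add_distrib]
  · calc ∑ v ∈ s, f v
        ≤ ∑ v ∈ s, (if (primesEquiv v : ℕ) ∈ S then g (primesEquiv v : ℕ) else 0) :=
          Finset.sum_le_sum fun v _ ↦ hterm v
      _ = ∑ ℓ ∈ s.image (fun v ↦ (primesEquiv v : ℕ)), (if ℓ ∈ S then g ℓ else 0) := by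
          rw [Finset.sum_image]
          intro v _ w _ h
          exact primesEquiv.injective (Subtype.ext h)
      _ ≤ ∑ ℓ ∈ S, g ℓ := by
          rw [← Finset.sum_filter]
          refine Finset.sum_le_sum_of_subset_of_nonneg (fun ℓ hℓ ↦ (Finset.mem_filter.mp hℓ).2)
            fun _ _ _ ↦ Nat.zero_le _
  · haveI := Fact.mk (primesEquiv v).2
    haveI : (W.baseChange ℚ_[primesEquiv v]).IsElliptic :=
      inferInstanceAs (W.map (algebraMap ℚ ℚ_[primesEquiv v])).IsElliptic
    exact localTamagawaNumber_padic_ne_zero_holds (primesEquiv v) _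
  · haveI := Fact.mk (primesEquiv v).2
    haveI : (Wd.baseChange ℚ_[primesEquiv v]).IsElliptic :=
      inferInstanceAs (Wd.map (algebraMap ℚ ℚ_[primesEquiv v])).IsElliptic
    exact localTamagawaNumber_padic_ne_zero_holds (primesEquiv v) _

/-! ### Class level: (T2) from the two shapes at a JSW field -/

/-- **X11b, (ram) atom, off (T2α): the Euler-system half from the two Shimura-curve shapes at a
field of JSW §7.4.2 type — the numeric Tamagawa condition DISCHARGED.** For an X11b pair `(E,p)`,
`p ≥ 5`, with a (ram) witness `ℓ₀`: given a quadratic field `K` and a finite set `S` of odd primes,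
inert in `K` and multiplicative for `E`, such that every bad prime outside `S` splits in `K` (so
`p ∉ S` splits; `ℓ₀` may lie in `S` — the parity padding of `N⁻` — or outside), every split
multiplicative prime outside `S` très ramifié (`p ∤ ord_ℓ Δ_min`; in particular `E` is not
split-and-peu-ramifié at `p`), `L(E^{d_K},1) ≠ 0`, a globally minimal model `Wd` of the twist, and
a point `P ∈ E(K)` carrying (U-Sh) and (GZ-Sh) with the `N⁻`-term
`T = Σ_{ℓ∈S} ord_p(ord_ℓ Δ_min(E))`: `Typed.MissingUpperBoundAt E p`, from the PUBLISHED facts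
`hSk` (Skinner 2016 Thm. C, for the twist: multiplicative at `p`, irreducible, (ram) through `ℓ₀`
split or inert), `hGZK`, `hmod` and the tree's local theorems
(`padicValNat_tamagawaProduct_add_twist_le_of_inertSet`). What remains untyped for this atom is
exactly: the existence of such `(K, S)` with `L(E^{d_K},1) ≠ 0` (Friedberg–Hoffstein 1995 Thm. B
with prescribed local behaviour), the CM point `P = z_K^{N⁺,N⁻}` (JSW §4.3), (U-Sh) = JSW
Thm. 4.4.1 and (GZ-Sh) = the explicit Gross–Zagier formula on `X_{N⁺,N⁻}` in BSD normalisation at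
`p ∥ N`. Census (`HOME/b2b-bsdres-multr1-p2/shcensus/`, `N < 5·10⁵` ‖ `N < 2·10⁴`): of the
41 174 ‖ 1 372 pairs of (T2β)∖(T2α), 23 951 ‖ 731 admit such `(S, ℓ₀)` with `2 ∉ S`; the other
17 223 ‖ 641 have `ℓ = 2` among the offending primes (an inert `2` is not treated by the unit-twist
lemmas). CONDITIONAL; nothing booked; X11b stays CONSTRUCTION-SHAPED.
[cite: JetchevSkinnerWan2017, §7.4.2 (p. 31), Thm. 4.4.1 (p. 19), §4.1 (H) (p. 17)]
[cite: Skinner2016PacificMC, Thm. C (§1) and footnote 1] [cite: Miller2011LMS, Def. 1.1] -/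
theorem missingUpperBoundAt_of_classX11b_of_shimuraShapes_inertSet
    -- published inputs (named facts of the tree)
    (hSk : Skinner2016.thmC_padicValRat_bsd_rank_zero)
    (hGZK : rank_eq_analyticRank_of_analyticRank_le_one) (hmod : hasEntireLFunction_rat)
    -- the pair, with a (ram) witness `ℓ₀`
    (W : WeierstrassCurve ℚ) [W.IsElliptic] [W.IsGloballyMinimal] (p : ℕ) [Fact p.Prime]
    (hX : ClassX11b W p) (hp5 : 5 ≤ p)
    {ℓ₀ : ℕ} [Fact ℓ₀.Prime] (hℓ₀ : ℓ₀ ≠ p) (hmult₀ : Mult W ℓ₀)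
    (hram₀ : ¬ p ∣ padicValInt ℓ₀ W.minimalDiscriminantInt)
    -- the field and the inert set
    (K : Type) [Field K] [NumberField K] (h2 : Module.finrank ℚ K = 2) (S : Finset ℕ) (hpS : p ∉ S)
    (hS : ∀ ℓ ∈ S, ∃ _ : Fact ℓ.Prime, ℓ ≠ 2 ∧ jacobiSym (NumberField.discr K) ℓ = -1 ∧ Mult W ℓ)
    (hsplit : ∀ (ℓ : ℕ) [Fact ℓ.Prime], ¬ W.HasGoodReductionAtPrime ℓ → ℓ ∉ S →
      IsSquare (algebraMap ℚ ℚ_[ℓ] (NumberField.discr K : ℚ)))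
    (hFC : ∀ (ℓ : ℕ) [Fact ℓ.Prime], ℓ ∉ S → W.HasSplitMultiplicativeReductionAtPrime ℓ →
      ¬ p ∣ padicValInt ℓ W.minimalDiscriminantInt)
    -- the twist
    (hLt : (W.quadraticTwist (NumberField.discr K : ℚ)).entireLFunction 1 ≠ 0)
    (Wd : WeierstrassCurve ℚ) [Wd.IsElliptic] [Wd.IsGloballyMinimal] (Cd : VariableChange ℚ)
    (hWd : Cd • W.quadraticTwist (NumberField.discr K : ℚ) = Wd)
    -- the point and the two shapes, with the `N⁻`-term of `S`
    (P : (W.baseChange K).toAffine.Point)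
    (hGZSh : ∃ qE qd : ℚ, qE ≠ 0 ∧ qd ≠ 0 ∧
      W.leadingLCoeff / ((W.realPeriodRat : ℂ) * (W.regulator : ℂ)) = (qE : ℂ) ∧
      Wd.entireLFunction 1 / (Wd.realPeriodRat : ℂ) = (qd : ℂ) ∧
      (2 * padicValNat p (AddSubgroup.zmultiples P).index : ℤ) +
          (∑ ℓ ∈ S, padicValNat p (padicValInt ℓ W.minimalDiscriminantInt) : ℕ) =
        padicValRat p qE + padicValRat p qd)
    (hUSh : Nat.card (AddCommGroup.primaryComponent (W.baseChange K).sha p) ≤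
      p ^ (2 * padicValNat p (AddSubgroup.zmultiples P).index)) :
    Typed.MissingUpperBoundAt W p := by
  obtain ⟨hr, -, hmult, hirr⟩ := hX
  have hp2 : p ≠ 2 := by omega
  have hp3 : 3 ≤ p := by omega
  have hD0 : (NumberField.discr K : ℚ) ≠ 0 := by exact_mod_cast NumberField.discr_ne_zero K
  haveI hEt : (W.quadraticTwist (NumberField.discr K : ℚ)).IsElliptic :=
    W.isElliptic_quadraticTwist hD0
  have hsqp : IsSquare (algebraMap ℚ ℚ_[p] (NumberField.discr K : ℚ)) :=
    hsplit p (WeierstrassCurve.HasMultiplicativeReduction.not_hasGoodReduction (R := ℤ_[p]) hmult) hpS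
  have hT := padicValNat_tamagawaProduct_add_twist_le_of_inertSet W p hp5 K Cd hWd S hS
    (fun ℓ _ hg hℓS ↦ hsplit ℓ hg hℓS) (fun ℓ _ hℓS hs ↦ hFC ℓ hℓS hs)
  -- the twist: multiplicative at `p`, irreducible, (ram) through `ℓ₀` (split or inert)
  have hmultd : Wd.HasMultiplicativeReductionAtPrime p := by
    rw [← hWd, hasMultiplicativeReductionAtPrime_smul_iff]
    exact (hasMultiplicativeReductionAtPrime_quadraticTwist_iff W hD0 hsqp).mpr hmult
  have hirrd : Wd.HasIrreducibleModPGaloisRep p :=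
    hasIrreducibleModPGaloisRep_twist_model W p K h2 hirr Cd hWd
  have hramd : Ram Wd p := by
    by_cases h0S : ℓ₀ ∈ S
    · obtain ⟨_, h02, hJ0, -⟩ := hS ℓ₀ h0S
      exact ram_twist_of_inert_witness W K Cd hWd ℓ₀ h02 hJ0 p hℓ₀ hmult₀ hram₀
    · have hsq₀ : IsSquare (algebraMap ℚ ℚ_[ℓ₀] (NumberField.discr K : ℚ)) :=
        hsplit ℓ₀ (WeierstrassCurve.HasMultiplicativeReduction.not_hasGoodReduction (R := ℤ_[ℓ₀])
          hmult₀) h0S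
      refine ⟨ℓ₀, inferInstance, hℓ₀, ?_, ?_⟩
      · rw [← hWd, hasMultiplicativeReductionAtPrime_smul_iff]
        exact (hasMultiplicativeReductionAtPrime_quadraticTwist_iff W hD0 hsq₀).mpr hmult₀
      · rwa [padicValInt_minimalDiscriminantInt_twist_eq W ℓ₀ hD0 hsq₀ Cd hWd]
  -- Skinner's Thm. C for the twist, then the bookkeeping core
  have hLt' : (W.quadraticTwist (NumberField.discr K : ℚ)).entireLFunction = Wd.entireLFunction := by
    rw [← hWd, entireLFunction_smul]
  have hLd1 : Wd.entireLFunction 1 ≠ 0 := by rw [← hLt']; exact hLt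
  have hfinSd : Wd.ShaFinite := (hGZK Wd (by
    rw [(Wd.analyticRank_eq_zero_iff_holds (hmod Wd)).2 hLd1]; omega)).2
  have hfinW : W.ShaFinite := (hGZK W (by omega)).2
  obtain ⟨qd, hqd, hvqd⟩ := hSk Wd p hp3 (Or.inr hmultd) hirrd hramd hLd1 hfinSd
  exact missingUpperBoundAt_of_shimuraShapes W p hp2 K h2 Wd ⟨Cd, hWd⟩ hfinW hfinSd P _ hT
    ⟨qd, hqd, hvqd.le⟩ hGZSh hUSh

end Summit.BirchSwinnertonDyer.Rank1Residual.X11b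

end
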